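/-
Copyright (c) 2026 the pub-hodgecm-mathlib formalisation cell (harness21).  Prover seat hodgecm-mathlib-K2E5-p16 (g6), Track B «K2-LIT»,
#184♮ = hLiu418 = `stmt-HodgeConjecture-24832`; #42S organ S2 (RULING «M-158f», DESIGN-S2 41bd43fff4457fcc §3 (ii)), file S2-P PART D
`K2LiuU22CompactPictureRootTypes`: COMPLEXIFICATION of the compact-picture Lie derivative (`𝒟_{X₁+iX₂} := 𝒟_{X₁} + i𝒟_{X₂}`, conjugation
`θX = J Xᴴ J` of `𝔤_ℂ` w.r.t. `𝔲(J)`), the block formula `denom (k_u X) Z`, and the three ROOT TYPES `X⁺(N)`, `X⁻(N)`, `𝔨(A,B)` (Cayley images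
of `(0 N; 0 0)`, `(0 0; N 0)`, `diag(A,B)`): their `W^± = denom (k_u X) (±i1)` — hence `τ_X(u)`, `V_X(u)` — and their `θ`-partners.
THEOREMS ONLY (no `def`, no `instance`, no notation, no named-fact hypothesis, no `sorry`; generic rank `l`).
-/
import Summits.HodgeConjecture.HodgeConjecture.Theorems.K2LiuU22CompactPicturePOperatorsExp   -- S2-P part C (this seat)
import Summits.HodgeConjecture.HodgeConjecture.Theorems.K2LiuLieRayDifferentiability          -- ★ `conjTranspose_exp_mul_J_mul_exp`, `conjTranspose_eq_of_mem_lie`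
import HarnessLib

/-!
# Crux `HLiu418`, organ S2, S2-P part D: complexification and the root types in the compact picture

Cell `hodgecm-mathlib`, crux item hLiu418 = `stmt-HodgeConjecture-24832` (helper lane `--supports`, count-neutral).

Parts B∕C give, for `X ∈ 𝔲(J)` (`XᴴJ + JX = 0`, so `exp(tX) ∈ U(J)` by ★ `conjTranspose_exp_mul_J_mul_exp`),
`𝒟_X A(k_u) := d∕dt|₀ A(k_u exp(tX)) = ((m∕2 − k)·τ_X(u) + (m∕2)·conj τ_X(u))·A(k_u) + G′_X`, `τ_X(u) = tr denom (k_uX) (−i1)`, `m = k − 2s − l`.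
The root generators live in `𝔤_ℂ = 𝔤𝔩_{2l}(ℂ)`; the representation-theoretic `𝒟_X` for complex `X` is the ℂ-LINEAR EXTENSION.  This file:
* §0 the conjugation `θX := J Xᴴ J` (`θ = id` on `𝔲(J)`), the real and imaginary parts `X₁ = ½(X + θX)`, `X₂ = (2i)⁻¹(X − θX) ∈ 𝔲(J)`,
  `X₁ + i·X₂ = X`, `X₁ − i·X₂ = θX`;
* §1 `denom` is ℂ-linear in the matrix; **`denom_kU_mul`**: `denom (k_u X) Z = ½·(i(1−u)·num X Z + (1+u)·denom X Z)`;
* §2 **`multiplier_complexified`**: `c_{X₁} + i·c_{X₂} = (m∕2 − k)·τ_X(u) + (m∕2)·conj τ_{θX}(u)` (so, with ★ `hasDerivAt_section_kU_exp` for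
  `X₁, X₂ ∈ 𝔲(J)`, `𝒟_X A(k_u) := 𝒟_{X₁}A + i𝒟_{X₂}A = ((m∕2 − k)τ_X + (m∕2) conj τ_{θX})·A(k_u) + DF[V_X]`) — the only change against the real
  formula is `conj τ_X ↦ conj τ_{θX}`; **`velocity_complexified`**: `V_{X₁} + i·V_{X₂} = V_X := denom (k_uX) (i1) − denom (k_uX) (−i1)·u`;
* §3 the ROOT TYPES: `X⁺(N) = (N iN; iN −N)`: `W⁺ = −2N`, `W⁻ = 0` (so `τ = 0`, `V = −2N`: constant field), `θX⁺(N) = X⁻(Nᴴ)`;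
  `X⁻(N) = (N −iN; −iN −N)`: `W⁺ = 0`, `W⁻ = −2uN` (so `τ = −2tr(uN)`, `V = 2uNu`), `θX⁻(N) = X⁺(Nᴴ)`;
  `𝔨(A,B) = (A+B  −i(A−B); i(A−B)  A+B)`: `W⁺ = 2uB`, `W⁻ = 2A` (so `τ = 2trA`, `V = 2(uB − Au)`);
  and `conj tr(u Nᴴ) = tr(N uᴴ)` (`= tr(N u⁻¹)` on `U(l)`): `𝒟_{X⁺(N)} = −m·tr(N u⁻¹)·(·) − ∂_{2N}` is of P-TYPE (coefficient `−m∕2·2 = 2p`… see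
  ref1 (r3)), `𝒟_{X⁻(N)}` of M-TYPE (ref1 PREP-S2 §1, DESIGN-S2 §3 (ii); signs∕factor 2 for the third reader).
* §4 (K2Liu-ref1 (r3) table) the GENERAL generator `X = C·(α β; γ δ)·C′`: `W⁺ = uδ − β`, `W⁻ = α − uγ`, so `τ_X = tr α − tr(uγ)`,
  `V_X = uδ − β − αu + uγu` (PREP-S2 §1 letter for letter); per block: `β ↦ pOp`, `γ ↦ mOp`, `α ↦ lOp`-type, `δ ↦ rOp`-type (★ p860097).
References: [Knapp1986, Ch. VI §2, VIII §3]; [LeeZhu1998, p. 5032]; [Shimura1997, §16.4].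
HONEST LABEL: HC_CM is proved only modulo the 7 printed citations (2 remaining named inputs: hLiu418 = stmt-HodgeConjecture-24832,
h413 = stmt-HodgeConjecture-24833) until rung 0 closes; count-neutral helper, closes no socket.
-/

set_option autoImplicit false
set_option linter.dupNamespace false

noncomputable section

open Complex Matrix NormedSpace
open scoped ComplexConjugate

namespace Summit.HodgeConjecture.HodgeConjecture.Cruxes.HLiu418.K2LiuU22CompactPictureRootTypes

open Literature.NumberTheory.ModularForms.SiegelUpperHalfSpace (num denom moeb num_def denom_def moeb_def num_fromBlocks denom_fromBlocks
  denom_mul num_mul)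
open Summit.HodgeConjecture.HodgeConjecture.Cruxes.HLiu418.K2LiuHermitianTubeCocycle
open Summit.HodgeConjecture.HodgeConjecture.Cruxes.HLiu418.K2LiuHermitianTubeFramePMinus (I_smul_one_mul)
open Summit.HodgeConjecture.HodgeConjecture.Cruxes.HLiu418.K2LiuArchInducedTubeDefs
open Summit.HodgeConjecture.HodgeConjecture.Cruxes.HLiu418.K2LiuLieRayDifferentiability (conjTranspose_exp_mul_J_mul_exp conjTranspose_eq_of_mem_lie)
open Summit.HodgeConjecture.HodgeConjecture.Cruxes.HLiu418.K2LiuU22ShilovCoordinate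
open Summit.HodgeConjecture.HodgeConjecture.Cruxes.HLiu418.K2LiuU22CompactPicturePOperatorsExp

variable {l : Type*} [Fintype l] [DecidableEq l]

/-! ## §0  The conjugation `θX = J Xᴴ J` and the real∕imaginary parts -/

/-- `θ = id` on `𝔲(J)`: if `XᴴJ + JX = 0` then `J Xᴴ J = X`. [Knapp1986, Ch. VI §2] -/
theorem J_mul_conjTranspose_mul_J_of_mem {X : Matrix (l ⊕ l) (l ⊕ l) ℂ} (hX : Xᴴ * Matrix.J l ℂ + Matrix.J l ℂ * X = 0) :
    Matrix.J l ℂ * Xᴴ * Matrix.J l ℂ = X := by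
  rw [conjTranspose_eq_of_mem_lie hX]
  have hJJ : Matrix.J l ℂ * Matrix.J l ℂ = -1 := Matrix.J_squared l ℂ
  calc Matrix.J l ℂ * (Matrix.J l ℂ * X * Matrix.J l ℂ) * Matrix.J l ℂ
      = (Matrix.J l ℂ * Matrix.J l ℂ) * X * (Matrix.J l ℂ * Matrix.J l ℂ) := by simp only [Matrix.mul_assoc]
    _ = X := by rw [hJJ]; simp

/-- `θ` is an involution: `J (J Xᴴ J)ᴴ J = X`. [Knapp1986, Ch. VI §2] -/
theorem theta_theta (X : Matrix (l ⊕ l) (l ⊕ l) ℂ) :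
    Matrix.J l ℂ * (Matrix.J l ℂ * Xᴴ * Matrix.J l ℂ)ᴴ * Matrix.J l ℂ = X := by
  have hJJ : Matrix.J l ℂ * Matrix.J l ℂ = -1 := Matrix.J_squared l ℂ
  have hJH : (Matrix.J l ℂ)ᴴ = -Matrix.J l ℂ := by
    rw [Matrix.J, fromBlocks_conjTranspose]; simp [fromBlocks_neg]
  rw [conjTranspose_mul, conjTranspose_mul, conjTranspose_conjTranspose, hJH]
  calc Matrix.J l ℂ * (-Matrix.J l ℂ * (X * -Matrix.J l ℂ)) * Matrix.J l ℂ
      = (Matrix.J l ℂ * Matrix.J l ℂ) * X * (Matrix.J l ℂ * Matrix.J l ℂ) := by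
        simp only [Matrix.neg_mul, Matrix.mul_neg, neg_neg, Matrix.mul_assoc]
    _ = X := by rw [hJJ]; simp

/-- **The real part `X₁ = ½(X + θX)` lies in `𝔲(J)`.** [Knapp1986, Ch. VI §2] -/
theorem re_mem (X : Matrix (l ⊕ l) (l ⊕ l) ℂ) :
    ((2 : ℂ)⁻¹ • (X + Matrix.J l ℂ * Xᴴ * Matrix.J l ℂ))ᴴ * Matrix.J l ℂ +
        Matrix.J l ℂ * ((2 : ℂ)⁻¹ • (X + Matrix.J l ℂ * Xᴴ * Matrix.J l ℂ)) = 0 := by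
  have hJJ : Matrix.J l ℂ * Matrix.J l ℂ = -1 := Matrix.J_squared l ℂ
  have hJH : (Matrix.J l ℂ)ᴴ = -Matrix.J l ℂ := by
    rw [Matrix.J, fromBlocks_conjTranspose]; simp [fromBlocks_neg]
  have h2 : star ((2 : ℂ)⁻¹) = (2 : ℂ)⁻¹ := by simp
  rw [conjTranspose_smul, h2, conjTranspose_add, conjTranspose_mul, conjTranspose_mul, conjTranspose_conjTranspose, hJH, Matrix.smul_mul,
    Matrix.mul_smul, ← smul_add, Matrix.add_mul, Matrix.mul_add]
  have e1 : -Matrix.J l ℂ * (X * -Matrix.J l ℂ) * Matrix.J l ℂ = -(Matrix.J l ℂ * X) := by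
    simp only [Matrix.neg_mul, Matrix.mul_neg, neg_neg, Matrix.mul_assoc, hJJ, Matrix.mul_one]
  have e2 : Matrix.J l ℂ * (Matrix.J l ℂ * Xᴴ * Matrix.J l ℂ) = -(Xᴴ * Matrix.J l ℂ) := by
    rw [← Matrix.mul_assoc, ← Matrix.mul_assoc, hJJ]; simp
  rw [e1, e2]
  simp only [smul_eq_zero]
  right; abel

/-- **The imaginary part `X₂ = (2i)⁻¹(X − θX)` lies in `𝔲(J)`.** [Knapp1986, Ch. VI §2] -/
theorem im_mem (X : Matrix (l ⊕ l) (l ⊕ l) ℂ) :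
    ((2 * I : ℂ)⁻¹ • (X - Matrix.J l ℂ * Xᴴ * Matrix.J l ℂ))ᴴ * Matrix.J l ℂ +
        Matrix.J l ℂ * ((2 * I : ℂ)⁻¹ • (X - Matrix.J l ℂ * Xᴴ * Matrix.J l ℂ)) = 0 := by
  have hJJ : Matrix.J l ℂ * Matrix.J l ℂ = -1 := Matrix.J_squared l ℂ
  have hJH : (Matrix.J l ℂ)ᴴ = -Matrix.J l ℂ := by
    rw [Matrix.J, fromBlocks_conjTranspose]; simp [fromBlocks_neg]
  have h2 : star ((2 * I : ℂ)⁻¹) = -(2 * I : ℂ)⁻¹ := by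
    rw [Complex.star_def, map_inv₀, map_mul, Complex.conj_I, map_ofNat, mul_neg, inv_neg]
  rw [conjTranspose_smul, h2, conjTranspose_sub, conjTranspose_mul, conjTranspose_mul, conjTranspose_conjTranspose, hJH, Matrix.smul_mul,
    Matrix.mul_smul, neg_smul, ← sub_eq_neg_add, ← smul_sub, Matrix.sub_mul, Matrix.mul_sub] -- careful with the order of the two summands
  have e1 : -Matrix.J l ℂ * (X * -Matrix.J l ℂ) * Matrix.J l ℂ = -(Matrix.J l ℂ * X) := by
    simp only [Matrix.neg_mul, Matrix.mul_neg, neg_neg, Matrix.mul_assoc, hJJ, Matrix.mul_one]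
  have e2 : Matrix.J l ℂ * (Matrix.J l ℂ * Xᴴ * Matrix.J l ℂ) = -(Xᴴ * Matrix.J l ℂ) := by
    rw [← Matrix.mul_assoc, ← Matrix.mul_assoc, hJJ]; simp
  rw [e1, e2]
  simp only [smul_eq_zero]
  right; abel

/-- `X₁ + i·X₂ = X` and `X₁ − i·X₂ = θX`. [folklore] -/
theorem re_add_I_smul_im (X : Matrix (l ⊕ l) (l ⊕ l) ℂ) :
    (2 : ℂ)⁻¹ • (X + Matrix.J l ℂ * Xᴴ * Matrix.J l ℂ) + I • ((2 * I : ℂ)⁻¹ • (X - Matrix.J l ℂ * Xᴴ * Matrix.J l ℂ)) = X ∧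
      (2 : ℂ)⁻¹ • (X + Matrix.J l ℂ * Xᴴ * Matrix.J l ℂ) - I • ((2 * I : ℂ)⁻¹ • (X - Matrix.J l ℂ * Xᴴ * Matrix.J l ℂ)) =
        Matrix.J l ℂ * Xᴴ * Matrix.J l ℂ := by
  have hI : I * (2 * I : ℂ)⁻¹ = (2 : ℂ)⁻¹ := by
    rw [mul_inv, ← mul_assoc, mul_comm I, mul_assoc, mul_inv_cancel₀ I_ne_zero, mul_one]
  rw [smul_smul, hI]
  constructor
  · rw [← smul_add]; module
  · rw [← smul_sub]; module

/-! ## §1  `denom` is linear in the matrix; the block formula for `k_u · X` -/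

omit [Fintype l] [DecidableEq l] in
/-- the lower blocks are additive and homogeneous. [folklore] -/
theorem toBlocks_lower_add_smul (X Y : Matrix (l ⊕ l) (l ⊕ l) ℂ) (c : ℂ) :
    (X + Y).toBlocks₂₁ = X.toBlocks₂₁ + Y.toBlocks₂₁ ∧ (X + Y).toBlocks₂₂ = X.toBlocks₂₂ + Y.toBlocks₂₂ ∧
      (c • X).toBlocks₂₁ = c • X.toBlocks₂₁ ∧ (c • X).toBlocks₂₂ = c • X.toBlocks₂₂ :=
  ⟨by ext; rfl, by ext; rfl, by ext; rfl, by ext; rfl⟩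

omit [DecidableEq l] in
/-- `denom (X + Y) Z = denom X Z + denom Y Z`. [folklore] -/
theorem denom_add (X Y : Matrix (l ⊕ l) (l ⊕ l) ℂ) (Z : Matrix l l ℂ) : denom (X + Y) Z = denom X Z + denom Y Z := by
  obtain ⟨h21, h22, -, -⟩ := toBlocks_lower_add_smul X Y 1
  rw [denom_def, denom_def, denom_def, h21, h22, Matrix.add_mul]
  abel

omit [DecidableEq l] in
/-- `denom (c • X) Z = c • denom X Z`. [folklore] -/
theorem denom_smul (c : ℂ) (X : Matrix (l ⊕ l) (l ⊕ l) ℂ) (Z : Matrix l l ℂ) : denom (c • X) Z = c • denom X Z := by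
  obtain ⟨-, -, h21, h22⟩ := toBlocks_lower_add_smul X X c
  rw [denom_def, denom_def, h21, h22, Matrix.smul_mul, smul_add]

/-- **THE BLOCK FORMULA**: `denom (k_u · X) Z = ½·(i(1−u)·num X Z + (1+u)·denom X Z)` for ANY `X`, `Z`. [LeeZhu1998, p. 5032] -/
theorem denom_kU_mul (u : Matrix l l ℂ) (X : Matrix (l ⊕ l) (l ⊕ l) ℂ) (Z : Matrix l l ℂ) :
    denom (((2 : ℂ)⁻¹ • fromBlocks (1 + u) (-(I • (1 - u))) (I • (1 - u)) (1 + u) : Matrix (l ⊕ l) (l ⊕ l) ℂ) * X) Z =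
      (2 : ℂ)⁻¹ • ((I • (1 - u)) * num X Z + (1 + u) * denom X Z) := by
  rw [denom_mul, fromBlocks_smul, toBlocks_fromBlocks₂₁, toBlocks_fromBlocks₂₂, Matrix.smul_mul ((2 : ℂ)⁻¹) (I • (1 - u)),
    Matrix.smul_mul ((2 : ℂ)⁻¹) (1 + u), ← smul_add]

/-! ## §2  The complexified multiplier and velocity at a compact-picture point -/

/-- `τ` is ℂ-linear in `X`: `tr denom (k_u (Y₁ + c·Y₂)) Z = tr denom (k_u Y₁) Z + c · tr denom (k_u Y₂) Z`. [folklore] -/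
theorem trace_denom_kU_add_smul (u : Matrix l l ℂ) (Y₁ Y₂ : Matrix (l ⊕ l) (l ⊕ l) ℂ) (c : ℂ) (Z : Matrix l l ℂ) :
    (denom (((2 : ℂ)⁻¹ • fromBlocks (1 + u) (-(I • (1 - u))) (I • (1 - u)) (1 + u) : Matrix (l ⊕ l) (l ⊕ l) ℂ) * (Y₁ + c • Y₂)) Z).trace =
      (denom (((2 : ℂ)⁻¹ • fromBlocks (1 + u) (-(I • (1 - u))) (I • (1 - u)) (1 + u) : Matrix (l ⊕ l) (l ⊕ l) ℂ) * Y₁) Z).trace +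
        c * (denom (((2 : ℂ)⁻¹ • fromBlocks (1 + u) (-(I • (1 - u))) (I • (1 - u)) (1 + u) : Matrix (l ⊕ l) (l ⊕ l) ℂ) * Y₂) Z).trace := by
  set kU : Matrix (l ⊕ l) (l ⊕ l) ℂ := (2 : ℂ)⁻¹ • fromBlocks (1 + u) (-(I • (1 - u))) (I • (1 - u)) (1 + u) with hkU
  rw [Matrix.mul_add, Matrix.mul_smul kU c Y₂, denom_add, denom_smul, trace_add, trace_smul, smul_eq_mul]

/-- `V` is ℂ-linear in `X`: `V_{Y₁ + c·Y₂} = V_{Y₁} + c·V_{Y₂}`, `V_Y := denom (k_uY) (i1) − denom (k_uY) (−i1)·u`. [folklore] -/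
theorem velocity_add_smul (u : Matrix l l ℂ) (Y₁ Y₂ : Matrix (l ⊕ l) (l ⊕ l) ℂ) (c : ℂ) :
    denom (((2 : ℂ)⁻¹ • fromBlocks (1 + u) (-(I • (1 - u))) (I • (1 - u)) (1 + u) : Matrix (l ⊕ l) (l ⊕ l) ℂ) * (Y₁ + c • Y₂))
          (I • (1 : Matrix l l ℂ)) -
        denom (((2 : ℂ)⁻¹ • fromBlocks (1 + u) (-(I • (1 - u))) (I • (1 - u)) (1 + u) : Matrix (l ⊕ l) (l ⊕ l) ℂ) * (Y₁ + c • Y₂))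
          (-(I • (1 : Matrix l l ℂ))) * u =
      (denom (((2 : ℂ)⁻¹ • fromBlocks (1 + u) (-(I • (1 - u))) (I • (1 - u)) (1 + u) : Matrix (l ⊕ l) (l ⊕ l) ℂ) * Y₁) (I • (1 : Matrix l l ℂ)) -
          denom (((2 : ℂ)⁻¹ • fromBlocks (1 + u) (-(I • (1 - u))) (I • (1 - u)) (1 + u) : Matrix (l ⊕ l) (l ⊕ l) ℂ) * Y₁)
            (-(I • (1 : Matrix l l ℂ))) * u) +
        c • (denom (((2 : ℂ)⁻¹ • fromBlocks (1 + u) (-(I • (1 - u))) (I • (1 - u)) (1 + u) : Matrix (l ⊕ l) (l ⊕ l) ℂ) * Y₂) (I • (1 : Matrix l l ℂ)) -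
          denom (((2 : ℂ)⁻¹ • fromBlocks (1 + u) (-(I • (1 - u))) (I • (1 - u)) (1 + u) : Matrix (l ⊕ l) (l ⊕ l) ℂ) * Y₂)
            (-(I • (1 : Matrix l l ℂ))) * u) := by
  set kU : Matrix (l ⊕ l) (l ⊕ l) ℂ := (2 : ℂ)⁻¹ • fromBlocks (1 + u) (-(I • (1 - u))) (I • (1 - u)) (1 + u) with hkU
  rw [Matrix.mul_add, Matrix.mul_smul kU c Y₂, denom_add, denom_add, denom_smul, denom_smul, Matrix.add_mul,
    Matrix.smul_mul c (denom (kU * Y₂) (-(I • (1 : Matrix l l ℂ)))) u, smul_sub]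
  abel

/-- **THE COMPLEXIFIED MULTIPLIER**: with `c_Y := (m∕2 − k)·τ_Y + (m∕2)·conj τ_Y` (`τ_Y = tr denom (k_uY) (−i1)`, the multiplier of
★ `hasDerivAt_section_kU_exp` for `Y ∈ 𝔲(J)`) and the real∕imaginary parts `X₁ = ½(X + JXᴴJ)`, `X₂ = (2i)⁻¹(X − JXᴴJ)` of ANY complex `X`:
**`c_{X₁} + i·c_{X₂} = (m∕2 − k)·τ_X + (m∕2)·conj τ_{θX}`**, `θX = J Xᴴ J` — the multiplier of the ℂ-linear extension
`𝒟_X := 𝒟_{X₁} + i𝒟_{X₂}`; the only change against the real formula is `conj τ_X ↦ conj τ_{θX}`. [Knapp1986, Ch. VIII §3; LeeZhu1998, p. 5032] -/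
theorem multiplier_complexified (m₀ k₀ : ℂ) (u : Matrix l l ℂ) (X : Matrix (l ⊕ l) (l ⊕ l) ℂ) :
    (m₀ * (denom (((2 : ℂ)⁻¹ • fromBlocks (1 + u) (-(I • (1 - u))) (I • (1 - u)) (1 + u) : Matrix (l ⊕ l) (l ⊕ l) ℂ) *
            ((2 : ℂ)⁻¹ • (X + Matrix.J l ℂ * Xᴴ * Matrix.J l ℂ))) (-(I • (1 : Matrix l l ℂ)))).trace +
        k₀ * conj (denom (((2 : ℂ)⁻¹ • fromBlocks (1 + u) (-(I • (1 - u))) (I • (1 - u)) (1 + u) : Matrix (l ⊕ l) (l ⊕ l) ℂ) *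
            ((2 : ℂ)⁻¹ • (X + Matrix.J l ℂ * Xᴴ * Matrix.J l ℂ))) (-(I • (1 : Matrix l l ℂ)))).trace) +
      I * (m₀ * (denom (((2 : ℂ)⁻¹ • fromBlocks (1 + u) (-(I • (1 - u))) (I • (1 - u)) (1 + u) : Matrix (l ⊕ l) (l ⊕ l) ℂ) *
            ((2 * I : ℂ)⁻¹ • (X - Matrix.J l ℂ * Xᴴ * Matrix.J l ℂ))) (-(I • (1 : Matrix l l ℂ)))).trace +
        k₀ * conj (denom (((2 : ℂ)⁻¹ • fromBlocks (1 + u) (-(I • (1 - u))) (I • (1 - u)) (1 + u) : Matrix (l ⊕ l) (l ⊕ l) ℂ) *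
            ((2 * I : ℂ)⁻¹ • (X - Matrix.J l ℂ * Xᴴ * Matrix.J l ℂ))) (-(I • (1 : Matrix l l ℂ)))).trace) =
      m₀ * (denom (((2 : ℂ)⁻¹ • fromBlocks (1 + u) (-(I • (1 - u))) (I • (1 - u)) (1 + u) : Matrix (l ⊕ l) (l ⊕ l) ℂ) * X)
          (-(I • (1 : Matrix l l ℂ)))).trace +
        k₀ * conj (denom (((2 : ℂ)⁻¹ • fromBlocks (1 + u) (-(I • (1 - u))) (I • (1 - u)) (1 + u) : Matrix (l ⊕ l) (l ⊕ l) ℂ) *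
          (Matrix.J l ℂ * Xᴴ * Matrix.J l ℂ)) (-(I • (1 : Matrix l l ℂ)))).trace := by
  set kU : Matrix (l ⊕ l) (l ⊕ l) ℂ := (2 : ℂ)⁻¹ • fromBlocks (1 + u) (-(I • (1 - u))) (I • (1 - u)) (1 + u) with hkU
  set X₁ : Matrix (l ⊕ l) (l ⊕ l) ℂ := (2 : ℂ)⁻¹ • (X + Matrix.J l ℂ * Xᴴ * Matrix.J l ℂ) with hX₁
  set X₂ : Matrix (l ⊕ l) (l ⊕ l) ℂ := (2 * I : ℂ)⁻¹ • (X - Matrix.J l ℂ * Xᴴ * Matrix.J l ℂ) with hX₂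
  obtain ⟨hsum, hdiff⟩ := re_add_I_smul_im X
  -- `τ_{X₁} + iτ_{X₂} = τ_X` and `conj τ_{X₁} + i conj τ_{X₂} = conj τ_{X₁ − iX₂} = conj τ_{θX}`
  have hτ : (denom (kU * X) (-(I • (1 : Matrix l l ℂ)))).trace =
      (denom (kU * X₁) (-(I • (1 : Matrix l l ℂ)))).trace + I * (denom (kU * X₂) (-(I • (1 : Matrix l l ℂ)))).trace := by
    conv_lhs => rw [← hsum]
    exact trace_denom_kU_add_smul u X₁ X₂ I _
  have hτ' : (denom (kU * (Matrix.J l ℂ * Xᴴ * Matrix.J l ℂ)) (-(I • (1 : Matrix l l ℂ)))).trace =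
      (denom (kU * X₁) (-(I • (1 : Matrix l l ℂ)))).trace + (-I) * (denom (kU * X₂) (-(I • (1 : Matrix l l ℂ)))).trace := by
    conv_lhs => rw [← hdiff, sub_eq_add_neg, ← neg_smul]
    exact trace_denom_kU_add_smul u X₁ X₂ (-I) _
  rw [hτ, hτ', map_add, map_mul, map_neg, Complex.conj_I, neg_neg]
  ring

/-- **THE COMPLEXIFIED VELOCITY**: `V_{X₁} + i·V_{X₂} = V_X`. [folklore] -/
theorem velocity_complexified (u : Matrix l l ℂ) (X : Matrix (l ⊕ l) (l ⊕ l) ℂ) :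
    (denom (((2 : ℂ)⁻¹ • fromBlocks (1 + u) (-(I • (1 - u))) (I • (1 - u)) (1 + u) : Matrix (l ⊕ l) (l ⊕ l) ℂ) *
            ((2 : ℂ)⁻¹ • (X + Matrix.J l ℂ * Xᴴ * Matrix.J l ℂ))) (I • (1 : Matrix l l ℂ)) -
        denom (((2 : ℂ)⁻¹ • fromBlocks (1 + u) (-(I • (1 - u))) (I • (1 - u)) (1 + u) : Matrix (l ⊕ l) (l ⊕ l) ℂ) *
            ((2 : ℂ)⁻¹ • (X + Matrix.J l ℂ * Xᴴ * Matrix.J l ℂ))) (-(I • (1 : Matrix l l ℂ))) * u) +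
      I • (denom (((2 : ℂ)⁻¹ • fromBlocks (1 + u) (-(I • (1 - u))) (I • (1 - u)) (1 + u) : Matrix (l ⊕ l) (l ⊕ l) ℂ) *
            ((2 * I : ℂ)⁻¹ • (X - Matrix.J l ℂ * Xᴴ * Matrix.J l ℂ))) (I • (1 : Matrix l l ℂ)) -
        denom (((2 : ℂ)⁻¹ • fromBlocks (1 + u) (-(I • (1 - u))) (I • (1 - u)) (1 + u) : Matrix (l ⊕ l) (l ⊕ l) ℂ) *
            ((2 * I : ℂ)⁻¹ • (X - Matrix.J l ℂ * Xᴴ * Matrix.J l ℂ))) (-(I • (1 : Matrix l l ℂ))) * u) =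
      denom (((2 : ℂ)⁻¹ • fromBlocks (1 + u) (-(I • (1 - u))) (I • (1 - u)) (1 + u) : Matrix (l ⊕ l) (l ⊕ l) ℂ) * X) (I • (1 : Matrix l l ℂ)) -
        denom (((2 : ℂ)⁻¹ • fromBlocks (1 + u) (-(I • (1 - u))) (I • (1 - u)) (1 + u) : Matrix (l ⊕ l) (l ⊕ l) ℂ) * X)
          (-(I • (1 : Matrix l l ℂ))) * u := by
  set X₁ : Matrix (l ⊕ l) (l ⊕ l) ℂ := (2 : ℂ)⁻¹ • (X + Matrix.J l ℂ * Xᴴ * Matrix.J l ℂ) with hX₁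
  set X₂ : Matrix (l ⊕ l) (l ⊕ l) ℂ := (2 * I : ℂ)⁻¹ • (X - Matrix.J l ℂ * Xᴴ * Matrix.J l ℂ) with hX₂
  obtain ⟨hsum, -⟩ := re_add_I_smul_im X
  conv_rhs => rw [← hsum]
  exact (velocity_add_smul u X₁ X₂ I).symm

/-! ## §3  The root types -/

/-- **`X⁺(N) = (N iN; iN −N)`** (Cayley image of the Q-frame `(0 2N; 0 0)`): `num∕denom` at `±i1`. [Knapp1986, Ch. VI §2] -/
theorem num_denom_xPlus (N : Matrix l l ℂ) :
    num (fromBlocks N (I • N) (I • N) (-N)) (I • (1 : Matrix l l ℂ)) = (2 * I) • N ∧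
      denom (fromBlocks N (I • N) (I • N) (-N)) (I • (1 : Matrix l l ℂ)) = -(2 : ℂ) • N ∧
        num (fromBlocks N (I • N) (I • N) (-N)) (-(I • (1 : Matrix l l ℂ))) = 0 ∧
          denom (fromBlocks N (I • N) (I • N) (-N)) (-(I • (1 : Matrix l l ℂ))) = 0 := by
  refine ⟨?_, ?_, ?_, ?_⟩ <;>
    simp only [num_fromBlocks, denom_fromBlocks, Matrix.mul_neg, Matrix.mul_smul, Matrix.mul_one, smul_smul, I_mul_I,
      neg_smul, neg_neg, one_smul] <;> module

/-- **`X⁻(N) = (N −iN; −iN −N)`** (Cayley image of the Q-frame `(0 0; 2N 0)`): `num∕denom` at `±i1`. [Knapp1986, Ch. VI §2] -/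
theorem num_denom_xMinus (N : Matrix l l ℂ) :
    num (fromBlocks N (-(I • N)) (-(I • N)) (-N)) (I • (1 : Matrix l l ℂ)) = 0 ∧
      denom (fromBlocks N (-(I • N)) (-(I • N)) (-N)) (I • (1 : Matrix l l ℂ)) = 0 ∧
        num (fromBlocks N (-(I • N)) (-(I • N)) (-N)) (-(I • (1 : Matrix l l ℂ))) = -((2 * I) • N) ∧
          denom (fromBlocks N (-(I • N)) (-(I • N)) (-N)) (-(I • (1 : Matrix l l ℂ))) = -(2 : ℂ) • N := by
  refine ⟨?_, ?_, ?_, ?_⟩ <;>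
    simp only [num_fromBlocks, denom_fromBlocks, Matrix.mul_neg, Matrix.mul_smul, Matrix.mul_one, smul_smul,
      I_mul_I, smul_neg, neg_smul, neg_neg, one_smul] <;> module

/-- **`𝔨(A,B) = (A+B, −i(A−B); i(A−B), A+B)`** (Cayley image of `diag(A,B)`, ★ `cayley_conj_blockDiag`): `num∕denom` at `±i1`. [Knapp1986, Ch. VI §2] -/
theorem num_denom_kk (A B : Matrix l l ℂ) :
    num (fromBlocks (A + B) (-(I • (A - B))) (I • (A - B)) (A + B)) (I • (1 : Matrix l l ℂ)) = (2 * I) • B ∧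
      denom (fromBlocks (A + B) (-(I • (A - B))) (I • (A - B)) (A + B)) (I • (1 : Matrix l l ℂ)) = (2 : ℂ) • B ∧
        num (fromBlocks (A + B) (-(I • (A - B))) (I • (A - B)) (A + B)) (-(I • (1 : Matrix l l ℂ))) = -((2 * I) • A) ∧
          denom (fromBlocks (A + B) (-(I • (A - B))) (I • (A - B)) (A + B)) (-(I • (1 : Matrix l l ℂ))) = (2 : ℂ) • A := by
  refine ⟨?_, ?_, ?_, ?_⟩ <;>
    simp only [num_fromBlocks, denom_fromBlocks, Matrix.mul_neg, Matrix.mul_smul, Matrix.mul_one, smul_smul,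
      I_mul_I, neg_smul, one_smul, smul_sub, smul_add] <;> module

/-- **ROOT TYPE `X⁺(N)` IN THE COMPACT PICTURE**: `W⁺ = denom (k_u X⁺(N)) (i1) = −2N`, `W⁻ = 0`; hence `τ_{X⁺(N)}(u) = 0` and
`V_{X⁺(N)}(u) = −2N` (a CONSTANT vector field). [LeeZhu1998, p. 5032] -/
theorem denom_kU_xPlus (u N : Matrix l l ℂ) :
    denom (((2 : ℂ)⁻¹ • fromBlocks (1 + u) (-(I • (1 - u))) (I • (1 - u)) (1 + u) : Matrix (l ⊕ l) (l ⊕ l) ℂ) *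
          fromBlocks N (I • N) (I • N) (-N)) (I • (1 : Matrix l l ℂ)) = -(2 : ℂ) • N ∧
      denom (((2 : ℂ)⁻¹ • fromBlocks (1 + u) (-(I • (1 - u))) (I • (1 - u)) (1 + u) : Matrix (l ⊕ l) (l ⊕ l) ℂ) *
          fromBlocks N (I • N) (I • N) (-N)) (-(I • (1 : Matrix l l ℂ))) = 0 := by
  obtain ⟨h1, h2, h3, h4⟩ := num_denom_xPlus N
  have hI2 : (2 : ℂ) * I * I = -2 := by rw [mul_assoc, I_mul_I]; ring
  rw [denom_kU_mul, denom_kU_mul, h1, h2, h3, h4, Matrix.mul_zero, Matrix.mul_zero, add_zero, smul_zero]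
  refine ⟨?_, rfl⟩
  simp only [Matrix.mul_smul, Matrix.smul_mul, Matrix.sub_mul, Matrix.add_mul, Matrix.one_mul, smul_smul, hI2]
  module

/-- **ROOT TYPE `X⁻(N)` IN THE COMPACT PICTURE**: `W⁺ = 0`, `W⁻ = denom (k_u X⁻(N)) (−i1) = −2uN`; hence `τ_{X⁻(N)}(u) = −2tr(uN)` and
`V_{X⁻(N)}(u) = 2·uNu` (the QUADRATIC vector field). [LeeZhu1998, p. 5032] -/
theorem denom_kU_xMinus (u N : Matrix l l ℂ) :
    denom (((2 : ℂ)⁻¹ • fromBlocks (1 + u) (-(I • (1 - u))) (I • (1 - u)) (1 + u) : Matrix (l ⊕ l) (l ⊕ l) ℂ) *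
          fromBlocks N (-(I • N)) (-(I • N)) (-N)) (I • (1 : Matrix l l ℂ)) = 0 ∧
      denom (((2 : ℂ)⁻¹ • fromBlocks (1 + u) (-(I • (1 - u))) (I • (1 - u)) (1 + u) : Matrix (l ⊕ l) (l ⊕ l) ℂ) *
          fromBlocks N (-(I • N)) (-(I • N)) (-N)) (-(I • (1 : Matrix l l ℂ))) = -(2 : ℂ) • (u * N) := by
  obtain ⟨h1, h2, h3, h4⟩ := num_denom_xMinus N
  have hI2 : (2 : ℂ) * I * I = -2 := by rw [mul_assoc, I_mul_I]; ring
  rw [denom_kU_mul, denom_kU_mul, h1, h2, h3, h4, Matrix.mul_zero, Matrix.mul_zero, add_zero, smul_zero]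
  refine ⟨rfl, ?_⟩
  simp only [Matrix.mul_neg, Matrix.mul_smul, Matrix.smul_mul, Matrix.sub_mul, Matrix.add_mul, Matrix.one_mul, smul_smul, hI2]
  module

/-- **THE COMPACT LIE ALGEBRA `𝔨(A,B)` IN THE COMPACT PICTURE**: `W⁺ = 2uB`, `W⁻ = 2A`; hence `τ_{𝔨(A,B)}(u) = 2trA` and
`V_{𝔨(A,B)}(u) = 2(uB − Au)` (right∕left translation fields). [Knapp1986, Ch. VI §2] -/
theorem denom_kU_kk (u A B : Matrix l l ℂ) :
    denom (((2 : ℂ)⁻¹ • fromBlocks (1 + u) (-(I • (1 - u))) (I • (1 - u)) (1 + u) : Matrix (l ⊕ l) (l ⊕ l) ℂ) *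
          fromBlocks (A + B) (-(I • (A - B))) (I • (A - B)) (A + B)) (I • (1 : Matrix l l ℂ)) = (2 : ℂ) • (u * B) ∧
      denom (((2 : ℂ)⁻¹ • fromBlocks (1 + u) (-(I • (1 - u))) (I • (1 - u)) (1 + u) : Matrix (l ⊕ l) (l ⊕ l) ℂ) *
          fromBlocks (A + B) (-(I • (A - B))) (I • (A - B)) (A + B)) (-(I • (1 : Matrix l l ℂ))) = (2 : ℂ) • A := by
  obtain ⟨h1, h2, h3, h4⟩ := num_denom_kk A B
  have hI2 : (2 : ℂ) * I * I = -2 := by rw [mul_assoc, I_mul_I]; ring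
  rw [denom_kU_mul, denom_kU_mul, h1, h2, h3, h4]
  constructor
  · simp only [Matrix.mul_smul, Matrix.smul_mul, Matrix.sub_mul, Matrix.add_mul, Matrix.one_mul, smul_smul, hI2]
    module
  · simp only [Matrix.mul_neg, Matrix.mul_smul, Matrix.smul_mul, Matrix.sub_mul, Matrix.add_mul, Matrix.one_mul, smul_smul, hI2]
    module

/-- **THE `θ`-PARTNERS**: `θX⁺(N) = X⁻(Nᴴ)` and `θX⁻(N) = X⁺(Nᴴ)`. [Knapp1986, Ch. VI §2] -/
theorem theta_xPlus_xMinus (N : Matrix l l ℂ) :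
    Matrix.J l ℂ * (fromBlocks N (I • N) (I • N) (-N))ᴴ * Matrix.J l ℂ = fromBlocks Nᴴ (-(I • Nᴴ)) (-(I • Nᴴ)) (-Nᴴ) ∧
      Matrix.J l ℂ * (fromBlocks N (-(I • N)) (-(I • N)) (-N))ᴴ * Matrix.J l ℂ = fromBlocks Nᴴ (I • Nᴴ) (I • Nᴴ) (-Nᴴ) := by
  constructor <;>
  · rw [fromBlocks_conjTranspose, Matrix.J, fromBlocks_multiply, fromBlocks_multiply]
    simp

omit [DecidableEq l] in
/-- `conj tr(u Nᴴ) = tr(N uᴴ)` (so `= tr(N u⁻¹)` for unitary `u`): the `θ`-term of `𝒟_{X⁺(N)}` is the P-type multiplier `tr(βu⁻¹)`.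
[LeeZhu1998, p. 5032] -/
theorem conj_trace_mul_conjTranspose (u N : Matrix l l ℂ) : conj (u * Nᴴ).trace = (N * uᴴ).trace := by
  rw [starRingEnd_apply, ← Matrix.trace_conjTranspose, conjTranspose_mul, conjTranspose_conjTranspose]

/-! ## §4  The general Cayley-frame generator `X = C·(α β; γ δ)·C′` (K2Liu-ref1 (r3) table) -/

/-- **`denom (C·(a b; c d)·C′) (i1) = d − b` and `denom (C·(a b; c d)·C′) (−i1) = a − c`** for the Cayley pair `C = (1 1; i −i)`,
`C′ = ½(1 −i; 1 i)`. [Knapp1986, Ch. VI §2] -/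
theorem denom_cayley_conj (a b c d : Matrix l l ℂ) :
    denom (fromBlocks 1 1 (I • 1) (-(I • 1)) * fromBlocks a b c d * ((2 : ℂ)⁻¹ • fromBlocks 1 (-(I • 1)) 1 (I • 1)) : Matrix (l ⊕ l) (l ⊕ l) ℂ)
        (I • (1 : Matrix l l ℂ)) = d - b ∧
      denom (fromBlocks 1 1 (I • 1) (-(I • 1)) * fromBlocks a b c d * ((2 : ℂ)⁻¹ • fromBlocks 1 (-(I • 1)) 1 (I • 1)) : Matrix (l ⊕ l) (l ⊕ l) ℂ)
        (-(I • (1 : Matrix l l ℂ))) = a - c := by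
  have h1 : ∀ X : Matrix l l ℂ, (I • (1 : Matrix l l ℂ)) * X = I • X := fun X => (I_smul_one_mul X).1
  have h2 : ∀ X : Matrix l l ℂ, X * (I • (1 : Matrix l l ℂ)) = I • X := fun X => (I_smul_one_mul X).2
  -- unscaled first (no `2⁻¹` in the way of `i·i = −1`), then rescale
  have key : denom (fromBlocks 1 1 (I • 1) (-(I • 1)) * fromBlocks a b c d * fromBlocks 1 (-(I • 1)) 1 (I • 1) : Matrix (l ⊕ l) (l ⊕ l) ℂ)
        (I • (1 : Matrix l l ℂ)) = (2 : ℂ) • (d - b) ∧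
      denom (fromBlocks 1 1 (I • 1) (-(I • 1)) * fromBlocks a b c d * fromBlocks 1 (-(I • 1)) 1 (I • 1) : Matrix (l ⊕ l) (l ⊕ l) ℂ)
        (-(I • (1 : Matrix l l ℂ))) = (2 : ℂ) • (a - c) := by
    rw [fromBlocks_multiply, fromBlocks_multiply, denom_fromBlocks, denom_fromBlocks]
    simp only [h1, h2, Matrix.mul_one, Matrix.mul_neg, Matrix.neg_mul, smul_add, smul_neg, smul_sub, smul_smul, I_mul_I, neg_smul, neg_neg,
      one_smul]
    constructor <;> module
  rw [Matrix.mul_smul, denom_smul, denom_smul, key.1, key.2, smul_smul, smul_smul, inv_mul_cancel₀ two_ne_zero, one_smul, one_smul]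
  exact ⟨rfl, rfl⟩

/-- `k_u · (C·(a b; c d)·C′) = C·(a b; uc ud)·C′` (`k_u = C·diag(1,u)·C′`, `C′C = 1`). [Knapp1986, Ch. VI §2] -/
theorem kU_mul_cayley_conj (u a b c d : Matrix l l ℂ) :
    ((2 : ℂ)⁻¹ • fromBlocks (1 + u) (-(I • (1 - u))) (I • (1 - u)) (1 + u) : Matrix (l ⊕ l) (l ⊕ l) ℂ) *
        (fromBlocks 1 1 (I • 1) (-(I • 1)) * fromBlocks a b c d * ((2 : ℂ)⁻¹ • fromBlocks 1 (-(I • 1)) 1 (I • 1))) =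
      fromBlocks 1 1 (I • 1) (-(I • 1)) * fromBlocks a b (u * c) (u * d) * ((2 : ℂ)⁻¹ • fromBlocks 1 (-(I • 1)) 1 (I • 1)) := by
  rw [← cayley_diag_one_eq]
  have hTT : ((2 : ℂ)⁻¹ • fromBlocks 1 (-(I • 1)) 1 (I • 1)) * (fromBlocks 1 1 (I • 1) (-(I • 1)) : Matrix (l ⊕ l) (l ⊕ l) ℂ) = 1 :=
    K2LiuHermitianTubeFramePMinus.cayleyInv_mul_cayley
  have hD : (fromBlocks 1 0 0 u : Matrix (l ⊕ l) (l ⊕ l) ℂ) * fromBlocks a b c d = fromBlocks a b (u * c) (u * d) := by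
    rw [fromBlocks_multiply]; simp
  calc fromBlocks 1 1 (I • 1) (-(I • 1)) * fromBlocks 1 0 0 u * ((2 : ℂ)⁻¹ • fromBlocks 1 (-(I • 1)) 1 (I • 1)) *
        (fromBlocks 1 1 (I • 1) (-(I • 1)) * fromBlocks a b c d * ((2 : ℂ)⁻¹ • fromBlocks 1 (-(I • 1)) 1 (I • 1)))
      = fromBlocks 1 1 (I • 1) (-(I • 1)) * (fromBlocks 1 0 0 u *
          ((((2 : ℂ)⁻¹ • fromBlocks 1 (-(I • 1)) 1 (I • 1)) * (fromBlocks 1 1 (I • 1) (-(I • 1)) : Matrix (l ⊕ l) (l ⊕ l) ℂ)) *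
            fromBlocks a b c d)) * ((2 : ℂ)⁻¹ • fromBlocks 1 (-(I • 1)) 1 (I • 1)) := by
        simp only [Matrix.mul_assoc]
    _ = fromBlocks 1 1 (I • 1) (-(I • 1)) * fromBlocks a b (u * c) (u * d) * ((2 : ℂ)⁻¹ • fromBlocks 1 (-(I • 1)) 1 (I • 1)) := by
        rw [hTT, Matrix.one_mul, hD]

/-- **THE GENERAL GENERATOR IN THE COMPACT PICTURE** (ref1 (r3) table): for `X = C·(α β; γ δ)·C′`,
`W⁺ = denom (k_uX) (i1) = uδ − β` and `W⁻ = denom (k_uX) (−i1) = α − uγ`; hence `τ_X(u) = tr α − tr(uγ)` and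
`V_X(u) = W⁺ − W⁻u = uδ − β − αu + uγu` — PREP-S2 §1's vector field letter for letter. [LeeZhu1998, p. 5032; Knapp1986, Ch. VI §2] -/
theorem denom_kU_cayley_conj (u α β γ δ : Matrix l l ℂ) :
    denom (((2 : ℂ)⁻¹ • fromBlocks (1 + u) (-(I • (1 - u))) (I • (1 - u)) (1 + u) : Matrix (l ⊕ l) (l ⊕ l) ℂ) *
          (fromBlocks 1 1 (I • 1) (-(I • 1)) * fromBlocks α β γ δ * ((2 : ℂ)⁻¹ • fromBlocks 1 (-(I • 1)) 1 (I • 1)))) (I • (1 : Matrix l l ℂ)) =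
        u * δ - β ∧
      denom (((2 : ℂ)⁻¹ • fromBlocks (1 + u) (-(I • (1 - u))) (I • (1 - u)) (1 + u) : Matrix (l ⊕ l) (l ⊕ l) ℂ) *
          (fromBlocks 1 1 (I • 1) (-(I • 1)) * fromBlocks α β γ δ * ((2 : ℂ)⁻¹ • fromBlocks 1 (-(I • 1)) 1 (I • 1)))) (-(I • (1 : Matrix l l ℂ))) =
        α - u * γ := by
  rw [kU_mul_cayley_conj]
  exact denom_cayley_conj α β (u * γ) (u * δ)

end Summit.HodgeConjecture.HodgeConjecture.Cruxes.HLiu418.K2LiuU22CompactPictureRootTypes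

end
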